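import Mathlib.Analysis.SpecialFunctions.Log.Basic
import Mathlib.Analysis.SpecialFunctions.Exp
import Mathlib.Analysis.Calculus.MeanValue
import Mathlib.Algebra.Order.BigOperators.Group.Finset
import Summits.QuantumFields.YangMills.Theorems.FluctuationComparisonRegPrIntLS2BetaDetRepLocalRows
import Literature.Probability.RandomMatrixProducts.AndersonModel1DEstimates
import HarnessLib

/-!
# S2β · LINE g18-1 · DET-REP-B‴ — THE ONE-SIDED LOCAL-SUM FOUR-POINT DOOR: the DETN ∕ JACW value rows from FIRST-ORDER response rows only

Cell `ym3-torus` (rung R3: continuum `SU(2)` Yang–Mills on `T³` — NOT `d = 4`, NOT infinite volume, NOT a mass gap, NOT Clay); width seat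
`ym-ust-20520-w5` g16; helper of the crux `stmt-QuantumFields-20520` (`--supports … --as helper`, NOT a proof of it).  Lane: the organ row DET-REP-B‴
`stub_detRepB` of `Cruxes/FluctuationComparisonRegPrIntL/Lines/semiclassical_s2beta.lean` (registry v11.3; the ∘-edition v11.4 changes only window clauses,
not the two value rows).

THE TWO VALUE ROWS of `def DetRepB`‴ have ONE shape: for a functional `g` of the window datum read through the charted minimiser and a window
quadrilateral `U V W Z` (edges `U→V`, `W→Z` = the move of bond `b`; `U→W`, `V→Z` = the move of bond `b′`; `R = tdist(b.src, b′.src)`),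
`|g U − g V − (g W − g Z)| ≤ Cst·θBal_J²·e^{−(θ−θ₂)·R}` — DETN with `g = log det hessStd(…) − 2·log jV`, JACW with `g = log c.jac`.  In both cases print
gives `g` as a LOCAL SUM `g = Σ_a g_a` (JACW: the chart-of-record Jacobian IS a product over the coarse bonds, `Jac (V,z) = 1_{windows}·Π_c jd c z (V c)` in the
proof of ✓`…WregFibredChart.exists_fibredChart_iter`; DETN: the random-walk expansion of `log det` [Balaban1984PropagatorsII] (1.33)) whose terms respond to a
one-bond move of the datum with exponential decay in the distance to the moved bond — print's BACKGROUND RESPONSE DECAY [Balaban1985Variational] Thm 1 (9) p. 279.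

THIS FILE is the bookkeeping door from such rows to the value-row shape, in the edition that needs the LEAST from print: only FIRST-ORDER (one-edge)
responses of every term — NO mixed (second-order) response, no two-parameter family, no smoothness:
* §1 one term: `|(p−q)−(r−s)| ≤ |p−q|+|r−s|` and `≤ |p−r|+|q−s|`, hence ★`abs_fourPt_le_two_mul_exp_of_oneSided`: one-edge rows at rate `2θ` along BOTH
  edge pairs (`C·e^{−2θ·d}` for the `b`-edges, `C·e^{−2θ·d′}` for the `b′`-edges) give the TWO-PROFILE bound `2·C·e^{−θ·(d + d′)}` (the `min` of the two
  one-sided bounds; the rate halves — the honest price of using no second-order information);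
* §2 the sums: ★★`abs_fourPt_sum_le_of_oneSided_weighted` (per-term amplitudes `C a`, two-profile local sum `Σ_a C a·e^{−θ₂(d a + d′ a)} ≤ S`, separation
  `R ≤ d a + d′ a` ⟹ `|Δ²(Σ_a g a)| ≤ 2·S·e^{−(θ−θ₂)·R}`), ★★`abs_fourPt_sum_le_of_oneSided` (uniform amplitude `η₀`, one-profile local sum
  `Σ_a e^{−θ₂·d a} ≤ S_d` — the letters of px19 g10's second-order edition ✓`…S2BetaDetRepLocalRows.abs_fourPt_sum_le_of_twoProfile`), and
  ★`abs_fourPt_sum_le_of_oneSided_sq` — the literal right side `Cst·T²·e^{−(θ−θ₂)·R}` of the two rows (`η₀ = c·T²`, `Cst := 2·c·S_d`);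
* §3 where the one-edge rows come from: `oneSided_of_lipschitz` (a LOCAL Lipschitz letter `|g a u − g a u′| ≤ Λ·ρ a u u′` for any local discrepancy
  `ρ a` + a localised DISPLACEMENT row `ρ a (corner) (corner′) ≤ δ·e^{−2θ·d a}` — BRD as print states it — give the row with `C := Λ·δ`), and
  `abs_sub_le_of_deriv_path` ∕ `oneSided_of_deriv_path` (the edge is a `C¹` path `s ↦ g a (x s)` on `[0,1]` with `|d∕ds| ≤ C·e^{−2θ·d a}`: mean-value inequality);
* §4 the product edition for a Jacobian: lit ✓`abs_log_sub_log_le` (`0 < m ≤ x, y ⟹ |log x − log y| ≤ |x − y|∕m`, by name), `log_prod_eq_sum_log`, and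
  ★`abs_fourPt_log_prod_le_of_oneSided` — for `j a (corner) ≥ m > 0` with one-edge rows on the FACTORS, the 4-point of `log Π_a j a` obeys the value-row shape.
* §5 ON THE TORUS, ALL GEOMETRY DISCHARGED: ★★★`abs_fourPt_sum_le_of_oneSided_site` — for terms indexed by a type fibred over the sites of `T^{(j)}` (`site : ι → Site P j`,
  fibres of size `≤ m`; e.g. `ι = PBond P j`, `m = d`) with profiles `d a = |site a − x_b|₁`, `d′ a = |site a − x_{b′}|₁`, the separation and the local sum are px19 g10's
  ✓`hsep₂_of_site` ∕ ✓`hSd_of_site` BY NAME, so the four one-edge rows ALONE give `|Δ²(Σ_a g a)| ≤ (2·c·m·(2(1+θ₂⁻¹))^d)·T²·e^{−(θ−θ₂)·|x_b − x_{b′}|₁}` — the value row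
  with a constant uniform in the torus, the depth and the volume.
Complementary editions in the tree: px19 g10's SECOND-ORDER door (per-term mixed responses, full rate) and w5 g15's (K4) ✓`…ProductRowsTightness.fourPt_sum_eq_zero_of_blind`
(terms blind to one move contribute zero — here: `C a = 0`).

HONEST SCOPE.  Finite sums, `exp`∕`log` monotonicity and one mean-value inequality; def-free; default heartbeats; proves nothing of DET-REP-B‴ ∕ the response rows (BRD) ∕
the local-sum representations ∕ S2β ∕ the crux 20520; `YM3TorusSU2` NOT proved; the Yang–Mills mass gap (Clay) NOT proved.
References: [Balaban1985Variational] CMP 102 (1985) 277, Thm 1 (9)–(10) p. 279; [Balaban1984PropagatorsII] CMP 96 (1984) 223, (1.33); [GlimmJaffe1987] §18.2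
(cluster property of local sums); [Rudin1976] Thm 5.19 (mean-value inequality).
-/

set_option autoImplicit false

noncomputable section

open Finset Set

namespace Summit.QuantumFields.YangMills.Theorems.FluctuationComparisonRegPrIntLS2BetaLocalSumFourPointOneSided

/-! ## §1 One term: the mixed four-point is at most twice the smaller one-edge oscillation -/

/-- The mixed four-point against the two `b`-edges: `|(p − q) − (r − s)| ≤ |p − q| + |r − s|`. [folklore] -/
theorem abs_fourPt_le_add_of_b_edges (p q r s : ℝ) : |(p - q) - (r - s)| ≤ |p - q| + |r - s| :=
  abs_sub _ _

/-- The mixed four-point against the two `b′`-edges: `|(p − q) − (r − s)| ≤ |p − r| + |q − s|`. [folklore] -/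
theorem abs_fourPt_le_add_of_b'_edges (p q r s : ℝ) : |(p - q) - (r - s)| ≤ |p - r| + |q - s| := by
  have h : (p - q) - (r - s) = (p - r) - (q - s) := by ring
  rw [h]
  exact abs_sub _ _

/-- The mixed four-point is at most the smaller of the two edge-pair sums: `≤ min (x₁ + x₂) (y₁ + y₂)` for one-edge bounds `x₁, x₂` (the `b`-edges)
and `y₁, y₂` (the `b′`-edges). [folklore] -/
theorem abs_fourPt_le_min_of_oneSided {p q r s x₁ x₂ y₁ y₂ : ℝ} (h₁ : |p - q| ≤ x₁) (h₂ : |r - s| ≤ x₂) (h₃ : |p - r| ≤ y₁)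
    (h₄ : |q - s| ≤ y₂) : |(p - q) - (r - s)| ≤ min (x₁ + x₂) (y₁ + y₂) :=
  le_min ((abs_fourPt_le_add_of_b_edges p q r s).trans (add_le_add h₁ h₂))
    ((abs_fourPt_le_add_of_b'_edges p q r s).trans (add_le_add h₃ h₄))

/-- **Rate bookkeeping**: for `0 ≤ θ` and profiles `d, d′ : ℕ`, `min (e^{−2θ·d}, e^{−2θ·d′}) ≤ e^{−θ·(d + d′)}` in the usable form
«one of the two one-sided exponentials is below the two-profile exponential». [folklore] -/
theorem exp_two_mul_le_exp_add_or {θ : ℝ} (hθ : 0 ≤ θ) (d d' : ℕ) :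
    Real.exp (-(2 * θ * d)) ≤ Real.exp (-(θ * (d + d'))) ∨ Real.exp (-(2 * θ * d')) ≤ Real.exp (-(θ * (d + d'))) := by
  rcases le_total (d' : ℝ) d with h | h
  · left
    refine Real.exp_le_exp.2 ?_
    nlinarith [mul_le_mul_of_nonneg_left h hθ]
  · right
    refine Real.exp_le_exp.2 ?_
    nlinarith [mul_le_mul_of_nonneg_left h hθ]

/-- ★ **ONE TERM, ONE-SIDED ROWS ⟹ TWO-PROFILE BOUND.**  If the `b`-edge differences are `≤ C·e^{−2θ·d}` and the `b′`-edge differences are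
`≤ C·e^{−2θ·d′}` (`0 ≤ C`, `0 ≤ θ`), then `|(p − q) − (r − s)| ≤ 2·C·e^{−θ·(d + d′)}` — the mixed four-point of a term localised at two-profile position
`(d, d′)` from FIRST-ORDER information only (the rate halves: `2θ ↦ θ`). [cite: GlimmJaffe1987, §18.2] -/
theorem abs_fourPt_le_two_mul_exp_of_oneSided {p q r s C θ : ℝ} (hC : 0 ≤ C) (hθ : 0 ≤ θ) {d d' : ℕ}
    (h₁ : |p - q| ≤ C * Real.exp (-(2 * θ * d))) (h₂ : |r - s| ≤ C * Real.exp (-(2 * θ * d)))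
    (h₃ : |p - r| ≤ C * Real.exp (-(2 * θ * d'))) (h₄ : |q - s| ≤ C * Real.exp (-(2 * θ * d'))) :
    |(p - q) - (r - s)| ≤ 2 * C * Real.exp (-(θ * (d + d'))) := by
  rcases exp_two_mul_le_exp_add_or hθ d d' with h | h
  · calc |(p - q) - (r - s)| ≤ |p - q| + |r - s| := abs_fourPt_le_add_of_b_edges p q r s
      _ ≤ C * Real.exp (-(2 * θ * d)) + C * Real.exp (-(2 * θ * d)) := add_le_add h₁ h₂
      _ ≤ C * Real.exp (-(θ * (d + d'))) + C * Real.exp (-(θ * (d + d'))) :=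
          add_le_add (mul_le_mul_of_nonneg_left h hC) (mul_le_mul_of_nonneg_left h hC)
      _ = 2 * C * Real.exp (-(θ * (d + d'))) := by ring
  · calc |(p - q) - (r - s)| ≤ |p - r| + |q - s| := abs_fourPt_le_add_of_b'_edges p q r s
      _ ≤ C * Real.exp (-(2 * θ * d')) + C * Real.exp (-(2 * θ * d')) := add_le_add h₃ h₄
      _ ≤ C * Real.exp (-(θ * (d + d'))) + C * Real.exp (-(θ * (d + d'))) :=
          add_le_add (mul_le_mul_of_nonneg_left h hC) (mul_le_mul_of_nonneg_left h hC)
      _ = 2 * C * Real.exp (-(θ * (d + d'))) := by ring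

/-! ## §2 The sums: local-sum functionals with one-sided response rows have the DET-REP-B‴ value-row shape -/

section Sums

variable {X ι : Type*} [Fintype ι]

/-- The mixed four-point of a finite sum is the sum of the mixed four-points. [folklore] -/
theorem fourPt_sum_eq_sum_fourPt (g : ι → X → ℝ) (U V W Z : X) :
    (∑ a, g a U - ∑ a, g a V) - (∑ a, g a W - ∑ a, g a Z) = ∑ a, ((g a U - g a V) - (g a W - g a Z)) := by
  simp only [Finset.sum_sub_distrib]

/-- **Two-profile rate split**: `e^{−θ·(d+d′)} ≤ e^{−(θ−θ₂)·R}·e^{−θ₂·(d+d′)}` for `R ≤ d + d′` and `θ₂ ≤ θ`. [folklore] -/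
theorem exp_twoProfile_le_exp_sep_mul {θ θ₂ : ℝ} (hθ₂θ : θ₂ ≤ θ) {d d' R : ℕ} (hsep : R ≤ d + d') :
    Real.exp (-(θ * (d + d'))) ≤ Real.exp (-((θ - θ₂) * R)) * Real.exp (-(θ₂ * (d + d'))) := by
  rw [← Real.exp_add]
  refine Real.exp_le_exp.2 ?_
  have h : (R : ℝ) ≤ d + d' := by exact_mod_cast hsep
  nlinarith [mul_le_mul_of_nonneg_left h (sub_nonneg.2 hθ₂θ)]

/-- ★★ **THE ONE-SIDED LOCAL-SUM DOOR, WEIGHTED EDITION.**  Let `g a : X → ℝ` (`a : ι`) be the terms of a local sum, `U V W Z : X` a quadrilateral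
(`U→V`, `W→Z` the `b`-edges; `U→W`, `V→Z` the `b′`-edges), `d a`, `d′ a` the distances of term `a` to the two moved bonds, and suppose the FIRST-ORDER
response rows `|g a U − g a V|, |g a W − g a Z| ≤ C a·e^{−2θ·d a}` and `|g a U − g a W|, |g a V − g a Z| ≤ C a·e^{−2θ·d′ a}` (`0 ≤ C a`, `0 ≤ θ`), the
separation `R ≤ d a + d′ a` (every `a`) and the two-profile local sum `Σ_a C a·e^{−θ₂·(d a + d′ a)} ≤ S` (`θ₂ ≤ θ`).  Then
`|Σ_a g a U − Σ_a g a V − (Σ_a g a W − Σ_a g a Z)| ≤ 2·S·e^{−(θ−θ₂)·R}`.  (Terms blind to one of the two moves take `C a = 0`: w5 g15's (K4).)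
PRICE ∕ WHICH PRINT LETTER: this edition consumes ONLY the first-order background response [Balaban1985Variational] Thm 1 (9) (one-edge rows), and pays in the
RATE — rows at `2θ` give `e^{−(θ−θ₂)·R}`; px19 g10's ✓`…S2BetaDetRepLocalRows.abs_fourPt_sum_le_of_twoProfile` keeps the full rate but consumes the MIXED response (9)+(10).
[cite: Balaban1985Variational, Thm 1 (9) p. 279] [cite: GlimmJaffe1987, §18.2] -/
theorem abs_fourPt_sum_le_of_oneSided_weighted {g : ι → X → ℝ} {U V W Z : X} {C : ι → ℝ} {θ θ₂ S : ℝ} (hC : ∀ a, 0 ≤ C a) (hθ : 0 ≤ θ)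
    (hθ₂θ : θ₂ ≤ θ) {d d' : ι → ℕ}
    (hUV : ∀ a, |g a U - g a V| ≤ C a * Real.exp (-(2 * θ * d a))) (hWZ : ∀ a, |g a W - g a Z| ≤ C a * Real.exp (-(2 * θ * d a)))
    (hUW : ∀ a, |g a U - g a W| ≤ C a * Real.exp (-(2 * θ * d' a))) (hVZ : ∀ a, |g a V - g a Z| ≤ C a * Real.exp (-(2 * θ * d' a)))
    {R : ℕ} (hsep : ∀ a, R ≤ d a + d' a) (hS : ∑ a, C a * Real.exp (-(θ₂ * (d a + d' a))) ≤ S) :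
    |(∑ a, g a U - ∑ a, g a V) - (∑ a, g a W - ∑ a, g a Z)| ≤ 2 * S * Real.exp (-((θ - θ₂) * R)) := by
  rw [fourPt_sum_eq_sum_fourPt]
  have hterm : ∀ a, |(g a U - g a V) - (g a W - g a Z)| ≤
      2 * Real.exp (-((θ - θ₂) * R)) * (C a * Real.exp (-(θ₂ * (d a + d' a)))) := by
    intro a
    calc |(g a U - g a V) - (g a W - g a Z)| ≤ 2 * C a * Real.exp (-(θ * (d a + d' a))) :=
          abs_fourPt_le_two_mul_exp_of_oneSided (hC a) hθ (hUV a) (hWZ a) (hUW a) (hVZ a)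
      _ ≤ 2 * C a * (Real.exp (-((θ - θ₂) * R)) * Real.exp (-(θ₂ * (d a + d' a)))) :=
          mul_le_mul_of_nonneg_left (exp_twoProfile_le_exp_sep_mul hθ₂θ (hsep a)) (by have := hC a; positivity)
      _ = 2 * Real.exp (-((θ - θ₂) * R)) * (C a * Real.exp (-(θ₂ * (d a + d' a)))) := by ring
  calc |∑ a, ((g a U - g a V) - (g a W - g a Z))| ≤ ∑ a, |(g a U - g a V) - (g a W - g a Z)| := Finset.abs_sum_le_sum_abs _ _
    _ ≤ ∑ a, 2 * Real.exp (-((θ - θ₂) * R)) * (C a * Real.exp (-(θ₂ * (d a + d' a)))) := Finset.sum_le_sum fun a _ => hterm a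
    _ = 2 * Real.exp (-((θ - θ₂) * R)) * ∑ a, C a * Real.exp (-(θ₂ * (d a + d' a))) := by rw [Finset.mul_sum]
    _ ≤ 2 * Real.exp (-((θ - θ₂) * R)) * S := mul_le_mul_of_nonneg_left hS (by positivity)
    _ = 2 * S * Real.exp (-((θ - θ₂) * R)) := by ring

/-- **One-profile local sum dominates the two-profile one** (uniform amplitude): for `0 ≤ η₀`, `0 ≤ θ₂`,
`Σ_a η₀·e^{−θ₂·(d a + d′ a)} ≤ η₀·Σ_a e^{−θ₂·d a}`. [folklore] -/
theorem sum_const_mul_exp_twoProfile_le {η₀ θ₂ : ℝ} (hη₀ : 0 ≤ η₀) (hθ₂ : 0 ≤ θ₂) (d d' : ι → ℕ) :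
    ∑ a, η₀ * Real.exp (-(θ₂ * (d a + d' a))) ≤ η₀ * ∑ a, Real.exp (-(θ₂ * d a)) := by
  rw [Finset.mul_sum]
  refine Finset.sum_le_sum fun a _ => mul_le_mul_of_nonneg_left (Real.exp_le_exp.2 ?_) hη₀
  have h1 : (0 : ℝ) ≤ d' a := Nat.cast_nonneg _
  nlinarith [mul_nonneg hθ₂ h1]

/-- ★★ **THE ONE-SIDED LOCAL-SUM DOOR, UNIFORM EDITION** (the letters of px19 g10's second-order door ✓`…S2BetaDetRepLocalRows.abs_fourPt_sum_le_of_twoProfile`: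
uniform amplitude `η₀`, ONE-profile local sum `Σ_a e^{−θ₂·d a} ≤ S_d`, `0 ≤ θ₂ ≤ θ`): one-edge response rows `η₀·e^{−2θ·d a}` (the `b`-edges) and
`η₀·e^{−2θ·d′ a}` (the `b′`-edges) for every term and `R ≤ d a + d′ a` give `|Δ²(Σ_a g a)| ≤ 2·η₀·S_d·e^{−(θ−θ₂)·R}`.  Same price as the weighted
edition: first-order letter (9) only, rate `2θ ↦ θ − θ₂` (the second-order door keeps rate `θ − θ₂` from rows at `θ`).
[cite: Balaban1985Variational, Thm 1 (9) p. 279] [cite: GlimmJaffe1987, §18.2] -/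
theorem abs_fourPt_sum_le_of_oneSided {g : ι → X → ℝ} {U V W Z : X} {η₀ θ θ₂ Sd : ℝ} (hη₀ : 0 ≤ η₀) (hθ₂ : 0 ≤ θ₂) (hθ₂θ : θ₂ ≤ θ)
    {d d' : ι → ℕ}
    (hUV : ∀ a, |g a U - g a V| ≤ η₀ * Real.exp (-(2 * θ * d a))) (hWZ : ∀ a, |g a W - g a Z| ≤ η₀ * Real.exp (-(2 * θ * d a)))
    (hUW : ∀ a, |g a U - g a W| ≤ η₀ * Real.exp (-(2 * θ * d' a))) (hVZ : ∀ a, |g a V - g a Z| ≤ η₀ * Real.exp (-(2 * θ * d' a)))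
    {R : ℕ} (hsep : ∀ a, R ≤ d a + d' a) (hSd : ∑ a, Real.exp (-(θ₂ * d a)) ≤ Sd) :
    |(∑ a, g a U - ∑ a, g a V) - (∑ a, g a W - ∑ a, g a Z)| ≤ 2 * (η₀ * Sd) * Real.exp (-((θ - θ₂) * R)) :=
  abs_fourPt_sum_le_of_oneSided_weighted (fun _ => hη₀) (hθ₂.trans hθ₂θ) hθ₂θ hUV hWZ hUW hVZ hsep
    ((sum_const_mul_exp_twoProfile_le hη₀ hθ₂ d d').trans (mul_le_mul_of_nonneg_left hSd hη₀))

/-- ★ **THE LITERAL VALUE-ROW SHAPE** `Cst·T²·e^{−(θ−θ₂)·R}`: with amplitude `η₀ = c·T²` (`0 ≤ c`; `T = θBal_J` in DET-REP-B‴) the uniform edition reads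
`|Δ²(Σ_a g a)| ≤ (2·c·S_d)·T²·e^{−(θ−θ₂)·R}` — `Cst := 2·c·S_d`, uniform as soon as `c`, `S_d` are. [cite: Balaban1985Variational, Thm 1 (9) p. 279] -/
theorem abs_fourPt_sum_le_of_oneSided_sq {g : ι → X → ℝ} {U V W Z : X} {c T θ θ₂ Sd : ℝ} (hc : 0 ≤ c) (hθ₂ : 0 ≤ θ₂) (hθ₂θ : θ₂ ≤ θ)
    {d d' : ι → ℕ}
    (hUV : ∀ a, |g a U - g a V| ≤ c * T ^ 2 * Real.exp (-(2 * θ * d a))) (hWZ : ∀ a, |g a W - g a Z| ≤ c * T ^ 2 * Real.exp (-(2 * θ * d a)))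
    (hUW : ∀ a, |g a U - g a W| ≤ c * T ^ 2 * Real.exp (-(2 * θ * d' a))) (hVZ : ∀ a, |g a V - g a Z| ≤ c * T ^ 2 * Real.exp (-(2 * θ * d' a)))
    {R : ℕ} (hsep : ∀ a, R ≤ d a + d' a) (hSd : ∑ a, Real.exp (-(θ₂ * d a)) ≤ Sd) :
    |(∑ a, g a U - ∑ a, g a V) - (∑ a, g a W - ∑ a, g a Z)| ≤ (2 * c * Sd) * T ^ 2 * Real.exp (-((θ - θ₂) * R)) := by
  have h := abs_fourPt_sum_le_of_oneSided (by positivity : 0 ≤ c * T ^ 2) hθ₂ hθ₂θ hUV hWZ hUW hVZ hsep hSd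
  calc _ ≤ 2 * (c * T ^ 2 * Sd) * Real.exp (-((θ - θ₂) * R)) := h
    _ = (2 * c * Sd) * T ^ 2 * Real.exp (-((θ - θ₂) * R)) := by ring

end Sums

/-! ## §3 Where the one-edge rows come from: a local Lipschitz letter and a localised displacement, or a derivative bound along the edge -/

section Rows

variable {X ι : Type*}

/-- **One-edge row from LOCAL LIPSCHITZ + LOCALISED DISPLACEMENT.**  If the term `g a` reads the configuration through a local discrepancy `ρ a`
(`|g a u − g a u′| ≤ Λ·ρ a u u′`, `0 ≤ Λ` — e.g. `ρ a u u′ = Σ_{ℓ ∈ B(a)} dist1 (u ℓ) (u′ ℓ)` over the block pair of the coarse bond `a`) and the edge moves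
the configuration near `a` by `ρ a u u′ ≤ δ·e^{−2θ·d a}` (the background response to a one-bond move of the datum, localised at the moved bond:
[Balaban1985Variational] Thm 1 (9)), then `|g a u − g a u′| ≤ (Λ·δ)·e^{−2θ·d a}`. [cite: Balaban1985Variational, Thm 1 (9) p. 279] -/
theorem oneSided_of_lipschitz {g : ι → X → ℝ} {ρ : ι → X → X → ℝ} {Λ δ θ : ℝ} (hΛ : 0 ≤ Λ) {d : ι → ℕ} {a : ι} {u u' : X}
    (hLip : |g a u - g a u'| ≤ Λ * ρ a u u') (hdisp : ρ a u u' ≤ δ * Real.exp (-(2 * θ * d a))) :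
    |g a u - g a u'| ≤ Λ * δ * Real.exp (-(2 * θ * d a)) :=
  hLip.trans (by rw [mul_assoc]; exact mul_le_mul_of_nonneg_left hdisp hΛ)

/-- **The mean-value inequality on `[0,1]`** (real-valued): `|φ 1 − φ 0| ≤ M` when `φ` has derivative `φ′ s` at every `s ∈ [0,1]` with `|φ′ s| ≤ M`.
[cite: Rudin1976, Thm 5.19] -/
theorem abs_sub_le_of_deriv_path {φ φ' : ℝ → ℝ} {M : ℝ} (hφ : ∀ s ∈ Icc (0 : ℝ) 1, HasDerivAt φ (φ' s) s)
    (hM : ∀ s ∈ Icc (0 : ℝ) 1, |φ' s| ≤ M) : |φ 1 - φ 0| ≤ M := by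
  have h := norm_image_sub_le_of_norm_deriv_le_segment_01' (f := φ) (f' := φ') (C := M)
    (fun s hs => (hφ s hs).hasDerivWithinAt) (fun s hs => by
      rw [Real.norm_eq_abs]; exact hM s (Ico_subset_Icc_self hs))
  rwa [Real.norm_eq_abs] at h

/-- **One-edge row from a DERIVATIVE BOUND ALONG THE EDGE.**  If the edge is a path `x : ℝ → X` with `x 0 = u`, `x 1 = u′` along which `s ↦ g a (x s)` has a
derivative bounded by `C·e^{−2θ·d a}` on `[0,1]` (print's response estimate is a derivative bound along the analytic family of data), then
`|g a u − g a u′| ≤ C·e^{−2θ·d a}`. [cite: Balaban1985Variational, Thm 1 (9)-(10) p. 279] [cite: Rudin1976, Thm 5.19] -/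
theorem oneSided_of_deriv_path {g : ι → X → ℝ} {x : ℝ → X} {u u' : X} (h0 : x 0 = u) (h1 : x 1 = u') {a : ι} {φ' : ℝ → ℝ} {C θ : ℝ} {d : ι → ℕ}
    (hφ : ∀ s ∈ Icc (0 : ℝ) 1, HasDerivAt (fun s => g a (x s)) (φ' s) s) (hC : ∀ s ∈ Icc (0 : ℝ) 1, |φ' s| ≤ C * Real.exp (-(2 * θ * d a))) :
    |g a u - g a u'| ≤ C * Real.exp (-(2 * θ * d a)) := by
  rw [← h0, ← h1, abs_sub_comm]
  exact abs_sub_le_of_deriv_path hφ hC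

end Rows

/-! ## §4 The product edition: a Jacobian that is a product of local factors -/

section Product

variable {X ι : Type*} [Fintype ι]

-- `log` is `1∕m`-Lipschitz on `[m, ∞)` (`0 < m ≤ x, y ⟹ |log x − log y| ≤ |x − y|∕m`) is LANDED, statement-identical, as
-- ✓`Literature.Probability.RandomMatrixProducts.abs_log_sub_log_le` (gate `dedup.landed`; cite-not-restate) and is used BY NAME below.
open Literature.Probability.RandomMatrixProducts (abs_log_sub_log_le)

/-- `log Π_a j a = Σ_a log (j a)` for positive factors. [folklore] -/
theorem log_prod_eq_sum_log {j : ι → ℝ} (hj : ∀ a, 0 < j a) : Real.log (∏ a, j a) = ∑ a, Real.log (j a) :=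
  Real.log_prod fun a _ => (hj a).ne'

omit [Fintype ι] in
/-- **One-edge row for a `log`-factor from the factor's own row**: `0 < m ≤ j a u, j a u′` and `|j a u − j a u′| ≤ C·e^{−2θ·d a}` give
`|log (j a u) − log (j a u′)| ≤ (C∕m)·e^{−2θ·d a}`. [cite: Rudin1976, Thm 5.19] -/
theorem oneSided_log_of_factor {j : ι → X → ℝ} {m C θ : ℝ} (hm : 0 < m) {d : ι → ℕ} {a : ι} {u u' : X} (hu : m ≤ j a u) (hu' : m ≤ j a u')
    (hrow : |j a u - j a u'| ≤ C * Real.exp (-(2 * θ * d a))) :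
    |Real.log (j a u) - Real.log (j a u')| ≤ C / m * Real.exp (-(2 * θ * d a)) := by
  refine (abs_log_sub_log_le hm hu hu').trans ?_
  rw [div_mul_eq_mul_div]
  exact div_le_div_of_nonneg_right hrow hm.le

/-- ★ **THE PRODUCT EDITION — a Jacobian `Π_a j a` with local factors.**  Factors bounded below by `m > 0` at the four corners, one-edge rows ON THE FACTORS
`|j a U − j a V|, |j a W − j a Z| ≤ η₀·e^{−2θ·d a}` and `|j a U − j a W|, |j a V − j a Z| ≤ η₀·e^{−2θ·d′ a}` (`0 ≤ η₀`, `0 ≤ θ₂ ≤ θ`), separation `R ≤ d a + d′ a`,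
local sum `Σ_a e^{−θ₂·d a} ≤ S_d`: then the 4-point of `log Π_a j a` over the quadrilateral is `≤ 2·(η₀∕m)·S_d·e^{−(θ−θ₂)·R}` — the JACW-ROW shape for a
product Jacobian, from first-order factor responses. [cite: Balaban1985Variational, Thm 1 (9) p. 279] [cite: GlimmJaffe1987, §18.2] -/
theorem abs_fourPt_log_prod_le_of_oneSided {j : ι → X → ℝ} {U V W Z : X} {m η₀ θ θ₂ Sd : ℝ} (hm : 0 < m) (hη₀ : 0 ≤ η₀) (hθ₂ : 0 ≤ θ₂)
    (hθ₂θ : θ₂ ≤ θ) {d d' : ι → ℕ}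
    (hmU : ∀ a, m ≤ j a U) (hmV : ∀ a, m ≤ j a V) (hmW : ∀ a, m ≤ j a W) (hmZ : ∀ a, m ≤ j a Z)
    (hUV : ∀ a, |j a U - j a V| ≤ η₀ * Real.exp (-(2 * θ * d a))) (hWZ : ∀ a, |j a W - j a Z| ≤ η₀ * Real.exp (-(2 * θ * d a)))
    (hUW : ∀ a, |j a U - j a W| ≤ η₀ * Real.exp (-(2 * θ * d' a))) (hVZ : ∀ a, |j a V - j a Z| ≤ η₀ * Real.exp (-(2 * θ * d' a)))
    {R : ℕ} (hsep : ∀ a, R ≤ d a + d' a) (hSd : ∑ a, Real.exp (-(θ₂ * d a)) ≤ Sd) :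
    |(Real.log (∏ a, j a U) - Real.log (∏ a, j a V)) - (Real.log (∏ a, j a W) - Real.log (∏ a, j a Z))|
      ≤ 2 * (η₀ / m * Sd) * Real.exp (-((θ - θ₂) * R)) := by
  rw [log_prod_eq_sum_log fun a => hm.trans_le (hmU a), log_prod_eq_sum_log fun a => hm.trans_le (hmV a),
    log_prod_eq_sum_log fun a => hm.trans_le (hmW a), log_prod_eq_sum_log fun a => hm.trans_le (hmZ a)]
  exact abs_fourPt_sum_le_of_oneSided (g := fun a u => Real.log (j a u)) (div_nonneg hη₀ hm.le) hθ₂ hθ₂θ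
    (fun a => oneSided_log_of_factor hm (hmU a) (hmV a) (hUV a)) (fun a => oneSided_log_of_factor hm (hmW a) (hmZ a) (hWZ a))
    (fun a => oneSided_log_of_factor hm (hmU a) (hmW a) (hUW a)) (fun a => oneSided_log_of_factor hm (hmV a) (hmZ a) (hVZ a)) hsep hSd

end Product


/-! ## §5 On the torus: the geometry rows discharged by name (px19 g10's ✓`…S2BetaDetRepLocalRows`) -/

section Torus

open Literature.MathematicalPhysics.QuantumFieldTheory.Balaban1983to89
open Summit.QuantumFields.YangMills.Theorems.FluctuationComparisonRegPrIntLS2BetaDetRepLocalRows (hSd_of_site hsep₂_of_site)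

variable {P : Params} {j : ℕ} {X ι : Type*} [Fintype ι]

/-- ★★★ **THE ONE-SIDED LOCAL-SUM DOOR ON THE TORUS — ONLY THE FOUR ONE-EDGE ROWS REMAIN.**  Terms `g a` indexed by a type fibred over the sites of
`T^{(j)}` (`site : ι → Site P j` with fibres of size `≤ m`), the two moved bonds at sites `x_b`, `x_{b′}`, one-edge response rows
`|g a U − g a V|, |g a W − g a Z| ≤ c·T²·e^{−2θ·|site a − x_b|₁}` and `|g a U − g a W|, |g a V − g a Z| ≤ c·T²·e^{−2θ·|site a − x_{b′}|₁}` (`0 ≤ c`, `0 < θ₂ ≤ θ`):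
then `|Σ_a g a U − Σ_a g a V − (Σ_a g a W − Σ_a g a Z)| ≤ (2·c·m·(2(1+θ₂⁻¹))^d)·T²·e^{−(θ−θ₂)·|x_b − x_{b′}|₁}` — separation by ✓`hsep₂_of_site`, local sum by
✓`hSd_of_site`; the constant is uniform in the torus (hence in the depth `K − J` and the volume). [cite: Balaban1985Variational, Thm 1 (9) p. 279]
[cite: Balaban1983Higgs3, (2.15) p. 427] -/
theorem abs_fourPt_sum_le_of_oneSided_site (site : ι → Site P j) {m : ℕ} (hm : ∀ y, (univ.filter fun a => site a = y).card ≤ m)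
    (xb xb' : Site P j) {g : ι → X → ℝ} {U V W Z : X} {c T θ θ₂ : ℝ} (hc : 0 ≤ c) (hθ₂ : 0 < θ₂) (hθ₂θ : θ₂ ≤ θ)
    (hUV : ∀ a, |g a U - g a V| ≤ c * T ^ 2 * Real.exp (-(2 * θ * (Site.tdist (site a) xb : ℕ))))
    (hWZ : ∀ a, |g a W - g a Z| ≤ c * T ^ 2 * Real.exp (-(2 * θ * (Site.tdist (site a) xb : ℕ))))
    (hUW : ∀ a, |g a U - g a W| ≤ c * T ^ 2 * Real.exp (-(2 * θ * (Site.tdist (site a) xb' : ℕ))))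
    (hVZ : ∀ a, |g a V - g a Z| ≤ c * T ^ 2 * Real.exp (-(2 * θ * (Site.tdist (site a) xb' : ℕ)))) :
    |(∑ a, g a U - ∑ a, g a V) - (∑ a, g a W - ∑ a, g a Z)|
      ≤ (2 * c * (m * (2 * (1 + θ₂⁻¹)) ^ P.d)) * T ^ 2 * Real.exp (-((θ - θ₂) * (Site.tdist xb xb' : ℕ))) :=
  abs_fourPt_sum_le_of_oneSided_sq (d := fun a => Site.tdist (site a) xb) (d' := fun a => Site.tdist (site a) xb') hc hθ₂.le hθ₂θ
    hUV hWZ hUW hVZ (fun a => hsep₂_of_site site xb xb' a) (hSd_of_site site hm hθ₂ xb)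

end Torus

end Summit.QuantumFields.YangMills.Theorems.FluctuationComparisonRegPrIntLS2BetaLocalSumFourPointOneSided

end
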